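/-
Copyright (c) 2026 the pub-hodgecm-mathlib formalisation cell (harness21).  Prover seat hodgecm-mathlib-LH4-p18 (g0), req620 Track A «(D-RAM) FOUR-FRAME» squad, helper lane on
h413 = stmt-HodgeConjecture-24833 (count-neutral).  β-BOARD v1 row R5 «G₃ ε-BOUNDARY», half R5b, step (β3) SLOT 2 (LH7-p06 (g0) 16:03:41Z cut: slot 0 = LH7-p06, slots 1∕2 + head = this seat).
2026-09-04.
-/
import Summits.HodgeConjecture.HodgeConjecture.Theorems.F0P3cDyRamGlueClassCharSums              -- ★ (LH7-p07 (g0)): `sum_eq_zero_of_classIsometry_flip`, `normSign_eq_of_rel_near`; brings ★ Lit `WildQuadraticDatumNormSignConductor` toolkit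
import Summits.HodgeConjecture.HodgeConjecture.Theorems.F0P3cDyRamLabelledOddG3OrbitDecomposition  -- ★ p861619 (this seat): reps `M(g)`, `D(g)`, `_of_read`; brings ★ engine, ★ `shell_of_mem_stratum_G3_of_guard`
import Summits.HodgeConjecture.HodgeConjecture.Theorems.F0P3cDyRamLabelledOddBoundaryValueG3       -- ★ p861675 (LH7-p06 (g0)) (β1): `labelledOddCount_div_relIndex_twoSlot_latt_G3`
import Summits.HodgeConjecture.HodgeConjecture.Theorems.F0P3cDyRamLabelledOddBoundaryIndicatorsG3  -- ★ p861738 (LH7-p06 (g0)) (β2): `indicator_two_latt_G3_iff`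
import Summits.HodgeConjecture.HodgeConjecture.Theorems.F0P3cDyRamDiagonalGluedClassRepresentatives -- ★ (iv-c): `exists_fixed_class_representatives`
import Summits.HodgeConjecture.HodgeConjecture.Theorems.F0P3cDyRamValueClassLabelEquivariant      -- ★ p860316: `isTorusEquivariantLabel_valueClassLabel`
import Summits.HodgeConjecture.HodgeConjecture.Theorems.F0P3cDyRamTowerSignToken                  -- ★ p860771: `exists_towerSign_of_mcOfRecord_le` (the `e_B` token)
import Summits.HodgeConjecture.HodgeConjecture.Theorems.F0P3cDyRamStableCountTypeZero              -- ★ (LH4-p12): `v_diag_eq_one`, `diag_regular`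
import Summits.HodgeConjecture.HodgeConjecture.Theorems.F0P3cDyRamLabelledOddStageAOfRecord       -- ★ p860462: brings ★ `finite_unitTorus_orbit_of_mem_normalisedStableLattices`
import Summits.HodgeConjecture.HodgeConjecture.Theorems.F0P3cDyRamElementDatumParity             -- ★: `isoceles_of_isElementDatum`, `depth_mod_two_eq_of_isElementDatum`
import HarnessLib

/-!
# Crux `H413`, line LH4 «(D-RAM) FOUR-FRAME» — (β-BAL) Stage B, β-BOARD R5b (β3), SLOT 2: THE TWISTED SIGN SUM OF THE OWN SLOT VANISHES —
# `Σ_{g ∈ R} ω(g)·ω(1+g)·ω(1 + κ·g·(1+g)⁻¹) = 0` over a complete irredundant system of the fixed shell `|g| = |ϖ|^{2e}` modulo `𝔭^N`, `N ≥ 2e + 2d − 1`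

Cell `hodgecm-mathlib` (D-0151), FLOOR 0, crux item H413 = `stmt-HodgeConjecture-24833`, route `HCCMUnconditional`; squad F0∕P3c∕LH4.  THEOREMS ONLY (no `def`, no instance, no
notation, no `sorry`, default heartbeats); ★-only imports; lane `--supports stmt-HodgeConjecture-24833 --as helper` (count-neutral); pays NO row, states NO law.

WHY (R5b (β3), slot 2 = the OWN slot of tower 3).  On LH4-p18's orbit representatives `M(g)` (★ p861619) with polarisation `D(g) ∘ (0 2) = π₀^{−(ρ+t)}·(−(1+g)⁻¹, 1, g)`, LH7-p06 (g0)'s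
★ p861675 per-lattice value in slot `2` reads `ω(S(g))·ω(D₂(g))∕2 · [indicator₂] · w` with `S(g) = π₀^{−(ρ+t)}(1+g)⁻¹·π₀^{k₃}e_C·(1 + κ·g·(1+g)⁻¹)`, `κ = −e_B e_C⁻¹ π₀^{k₁}(π₀^{k₃})⁻¹`,
`ω(D₂(g)) = ω(g)`, and `[indicator₂] = [2d − 1 ≤ ρ]` (LH7-p06 (β2)); so past the indicator the `g`-sum is `ω(e_C) · Σ_{g ∈ R} ω(g)·ω(1+g)·ω(1 + κg(1+g)⁻¹)` over the ★ (iv-c) system `R`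
(fixed `g`, `|g| = |ϖ|^{2t}`, modulo `𝔭^{ρ+2t}`, `ρ ≥ 2d − 1`).  THIS FILE: that sum is `0` — the non-norm unit `c ∈ U_F` with `|c − 1| ≤ |ϖ|^{2d−2}` (★ `exists_fixed_unit_not_norm_v_sub_one_le`)
multiplies the shell into itself class-isometrically, FLIPS `ω(g)` (★ `normSign_mul_eq_neg_of_not_norm`) and MOVES NEITHER `ω(1+g)` nor `ω(1 + κg(1+g)⁻¹)` (both change by a fixed unit
`≡ 1 (mod ϖ^{2d−1})`, ★ `normSign_mul_eq_of_fixed_of_v_sub_one_le`; `e ≥ 1`, `|κ|·|ϖ|^{2e} ≤ |ϖ|`), and all three factors are class functions at precision `N ≥ 2e + 2d − 1` — LH7-p07's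
★ `sum_eq_zero_of_classIsometry_flip`.
* §1 `normSign_one_add_eq_of_sub_le` (class∕flip invariance of `ω(1+y)`), `normSign_twist_eq_of_sub_le` (the same for `ω(1 + κy(1+y)⁻¹)`).
* §2 HEAD **`sum_normSign_mul_one_add_mul_twist_eq_zero`**.
HONEST LABEL.  Count-neutral local arithmetic; R5b slot 2 ∕ head, table, (β-BAL), (β), T₊ OPEN; `HC_CM` is proved only modulo the 7 printed citations (2 remaining named inputs: hLiu418 =
`stmt-HodgeConjecture-24832`, h413 = `stmt-HodgeConjecture-24833`) until rung 0 closes.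

## References
* [Serre1979] J.-P. Serre, *Local Fields*, GTM 67 (1979), Ch. V §3 Prop. 5, Cor. 2–3; Ch. XV §2 (norm groups and the conductor of a ramified quadratic extension).
* [Kottwitz1986BaseChangeUnits] R. E. Kottwitz, *Base change for unit elements of Hecke algebras*, Compositio Math. 60 (1986), §1 pp. 240–241.
* [LanglandsShelstad1987] R. P. Langlands, D. Shelstad, *On the definition of transfer factors*, Math. Ann. 278 (1987), §3.
-/

set_option autoImplicit false

noncomputable section

namespace Summit.HodgeConjecture.HodgeConjecture.Cruxes.H413.F0P3cDyRamLabelledOddBoundaryG3SlotTwo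

open WithZero
open Literature.NumberTheory.Automorphic.UnitaryThreeFourFrame
open Literature.NumberTheory.LocalFields.WildQuadraticDatum
open Literature.NumberTheory.Automorphic Literature.NumberTheory.Automorphic.HermitianLattice Literature.NumberTheory.Automorphic.UnitaryLatticeTree
open Literature.NumberTheory.LocalFields
open Summit.HodgeConjecture.HodgeConjecture.Cruxes.H413.F0P3cDyRamGlueClassCharSums (sum_eq_zero_of_classIsometry_flip normSign_eq_of_rel_near)
open Summit.HodgeConjecture.HodgeConjecture.Cruxes.H413.F0P3cDyRamFourFramePieces
open Summit.HodgeConjecture.HodgeConjecture.Cruxes.H413.F0P3cDyRamFourFrameCensusDefs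
open Summit.HodgeConjecture.HodgeConjecture.Cruxes.H413.F0P3cDyRamStageOneBDefs (mcOfRecord)
open Summit.HodgeConjecture.HodgeConjecture.Cruxes.H413.F0P3cDyRamDiagonalTorusDefs
open Summit.HodgeConjecture.HodgeConjecture.Cruxes.H413.F0P3cDyRamDiagonalStrataDefs
open Summit.HodgeConjecture.HodgeConjecture.Cruxes.H413.F0P3cDyRamLabelledOddCountDefs
open Summit.HodgeConjecture.HodgeConjecture.Cruxes.H413.F0P3cDyRamLabelledOddG3OrbitDecomposition
open Summit.HodgeConjecture.HodgeConjecture.Cruxes.H413.F0P3cDyRamLabelledOddPureStrataG3Shell (shell_of_mem_stratum_G3_of_guard)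
open Summit.HodgeConjecture.HodgeConjecture.Cruxes.H413.F0P3cDyRamLabelledOddBoundaryValueG3 (labelledOddCount_div_relIndex_twoSlot_latt_G3)
open Summit.HodgeConjecture.HodgeConjecture.Cruxes.H413.F0P3cDyRamLabelledOddBoundaryIndicatorsG3 (indicator_two_latt_G3_iff)
open Summit.HodgeConjecture.HodgeConjecture.Cruxes.H413.F0P3cDyRamDiagonalGluedClassRepresentatives (exists_fixed_class_representatives)
open Summit.HodgeConjecture.HodgeConjecture.Cruxes.H413.F0P3cDyRamValueClassLabelEquivariant (isTorusEquivariantLabel_valueClassLabel)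
open Summit.HodgeConjecture.HodgeConjecture.Cruxes.H413.F0P3cDyRamTowerSignToken (exists_towerSign_of_mcOfRecord_le)
open Summit.HodgeConjecture.HodgeConjecture.Cruxes.H413.F0P3cDyRamStableCountTypeZero (v_diag_eq_one diag_regular)
open Summit.HodgeConjecture.HodgeConjecture.Cruxes.H413.F0P3cDyRamDiagonalOrbitFibreCountHeads (finite_unitTorus_orbit_of_mem_normalisedStableLattices)
open Summit.HodgeConjecture.HodgeConjecture.Cruxes.H413.F0P3cDyRamElementDatumParity (isoceles_of_isElementDatum depth_mod_two_eq_of_isElementDatum)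
open Summit.HodgeConjecture.HodgeConjecture.Cruxes.H413.F0P3cDyRamDiagonalGluedStabiliserIndex (ne_zero_and_v_lt_one_of_v_eq_exp)
open scoped Valued Matrix MatrixGroups

variable {K : Type} [Field K] [Valued K ℤᵐ⁰] {σ : K →+* K} {ϖ : K} {d t : ℕ}

/-! ## §1  The two unit factors are class functions and do not see the flip -/

/-- **`ω(1 + y′) = ω(1 + y)` WHEN `|y′ − y| ≤ |ϖ|^n`, `n ≥ 2d − 1`, `|y| < 1`** (`1 + y′ = (1 + y)·(1 + (y′−y)(1+y)⁻¹)` and the second factor is a norm, ★ `normSign_mul_eq_of_fixed_of_v_sub_one_le`).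
[cite: Serre1979, Ch. XV §2] -/
theorem normSign_one_add_eq_of_sub_le [CompleteSpace K] (hD : IsRamifiedQuadraticDatum σ ϖ d t) {y y' : K} (hσy : σ y = y) (hσy' : σ y' = y')
    (hy : Valued.v y < 1) {n : ℕ} (hn : 2 * d - 1 ≤ n) (hyy' : Valued.v (y' - y) ≤ Valued.v ϖ ^ n) :
    normSign σ (1 + y') = normSign σ (1 + y) := by
  have h1y : Valued.v (1 + y) = 1 := Valued.v.map_one_add_of_lt hy
  have h1y0 : (1 : K) + y ≠ 0 := fun h => by rw [h, map_zero] at h1y; exact zero_ne_one h1y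
  have hσ1y : σ (1 + y) = 1 + y := by rw [map_add, map_one, hσy]
  have e : 1 + y' = (1 + y) * (1 + (y' - y) * (1 + y)⁻¹) := by field_simp; ring
  rw [e]
  refine normSign_mul_eq_of_fixed_of_v_sub_one_le hD (1 + y) ?_ hn ?_
  · rw [map_add, map_one, map_mul, map_sub, hσy', hσy, map_inv₀, hσ1y]
  · rw [add_sub_cancel_left, map_mul, map_inv₀, h1y, inv_one, mul_one]
    exact hyy'

/-- **`ω(1 + κy′(1+y′)⁻¹) = ω(1 + κy(1+y)⁻¹)` WHEN `|κ·(y′ − y)| ≤ |ϖ|^n`, `n ≥ 2d − 1`, `|y|, |y′| < 1`, `|κy| < 1`** (the two twists differ by the fixed unit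
`1 + κ(y′−y)((1+y)(1+y′)(1 + κy(1+y)⁻¹))⁻¹ ≡ 1 (mod ϖ^n)`, a norm). [cite: Serre1979, Ch. XV §2] -/
theorem normSign_twist_eq_of_sub_le [CompleteSpace K] (hD : IsRamifiedQuadraticDatum σ ϖ d t) {κ y y' : K} (hσκ : σ κ = κ) (hσy : σ y = y) (hσy' : σ y' = y')
    (hy : Valued.v y < 1) (hy' : Valued.v y' < 1) (hκy : Valued.v (κ * y) < 1) {n : ℕ} (hn : 2 * d - 1 ≤ n) (hyy' : Valued.v (κ * (y' - y)) ≤ Valued.v ϖ ^ n) :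
    normSign σ (1 + κ * y' * (1 + y')⁻¹) = normSign σ (1 + κ * y * (1 + y)⁻¹) := by
  have h1y : Valued.v (1 + y) = 1 := Valued.v.map_one_add_of_lt hy
  have h1y' : Valued.v (1 + y') = 1 := Valued.v.map_one_add_of_lt hy'
  have h1y0 : (1 : K) + y ≠ 0 := fun h => by rw [h, map_zero] at h1y; exact zero_ne_one h1y
  have h1y'0 : (1 : K) + y' ≠ 0 := fun h => by rw [h, map_zero] at h1y'; exact zero_ne_one h1y'
  -- `ψ(y) = 1 + κy(1+y)⁻¹` is a fixed unit
  have hψv : Valued.v (1 + κ * y * (1 + y)⁻¹) = 1 :=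
    Valued.v.map_one_add_of_lt (by rw [map_mul, map_inv₀, h1y, inv_one, mul_one]; exact hκy)
  have hψ0 : 1 + κ * y * (1 + y)⁻¹ ≠ 0 := fun h => by rw [h, map_zero] at hψv; exact zero_ne_one hψv
  have hσψ : σ (1 + κ * y * (1 + y)⁻¹) = 1 + κ * y * (1 + y)⁻¹ := by
    rw [map_add, map_one, map_mul, map_mul, map_inv₀, map_add, map_one, hσκ, hσy]
  have hσψ' : σ (1 + κ * y' * (1 + y')⁻¹) = 1 + κ * y' * (1 + y')⁻¹ := by
    rw [map_add, map_one, map_mul, map_mul, map_inv₀, map_add, map_one, hσκ, hσy']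
  have hdiff : (1 + κ * y' * (1 + y')⁻¹) - (1 + κ * y * (1 + y)⁻¹) = κ * (y' - y) * ((1 + y) * (1 + y'))⁻¹ := by
    field_simp
    ring
  -- the ratio `ψ(y′)∕ψ(y)` is a fixed unit `≡ 1 (mod ϖ^n)`
  have e : 1 + κ * y' * (1 + y')⁻¹ = (1 + κ * y * (1 + y)⁻¹) * ((1 + κ * y' * (1 + y')⁻¹) * (1 + κ * y * (1 + y)⁻¹)⁻¹) := by
    set ψ : K := 1 + κ * y * (1 + y)⁻¹
    set ψ' : K := 1 + κ * y' * (1 + y')⁻¹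
    rw [mul_comm ψ' ψ⁻¹, ← mul_assoc, mul_inv_cancel₀ hψ0, one_mul]
  rw [e]
  refine normSign_mul_eq_of_fixed_of_v_sub_one_le hD _ ?_ hn ?_
  · rw [map_mul, map_inv₀, hσψ', hσψ]
  · have e2 : (1 + κ * y' * (1 + y')⁻¹) * (1 + κ * y * (1 + y)⁻¹)⁻¹ - 1 =
        ((1 + κ * y' * (1 + y')⁻¹) - (1 + κ * y * (1 + y)⁻¹)) * (1 + κ * y * (1 + y)⁻¹)⁻¹ := by
      rw [sub_mul, mul_inv_cancel₀ hψ0]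
    rw [e2, hdiff]
    simpa only [map_mul, map_inv₀, h1y, h1y', hψv, inv_one, mul_one] using hyy'

/-! ## §2  HEAD — the twisted own-slot sign sum vanishes -/

/-- **`Σ_{y ∈ S} ω(y)·ω(1+y)·ω(1 + κ·y·(1+y)⁻¹) = 0`** over a complete irredundant system `S` of the fixed shell `{σy = y, |y| = |ϖ|^{2e}}` modulo `𝔭^N` — complete `K` with finite
residue field, `|2| < 1`, `e ≥ 1`, `N ≥ 2e + 2d − 1`, `κ` fixed with `|κ|·|ϖ|^{2e} ≤ |ϖ|`: the non-norm `c ∈ U_F(2d−2)` (★ `exists_fixed_unit_not_norm_v_sub_one_le`) gives the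
class-isometric self-map `y ↦ cy` of the shell which flips `ω(y)` (★ `normSign_mul_eq_neg_of_not_norm`) and fixes the two unit factors (§1), so ★ `sum_eq_zero_of_classIsometry_flip` applies
(the R5b slot-2 `g`-sum past LH7-p06's indicator `[2d − 1 ≤ ρ]`, at `e = t`, `N = ρ + 2t`). [cite: Serre1979, Ch. V §3 Cor. 3; Ch. XV §2] [cite: LanglandsShelstad1987, §3]
[cite: Kottwitz1986BaseChangeUnits, §1 pp. 240–241] -/
theorem sum_normSign_mul_one_add_mul_twist_eq_zero [CompleteSpace K] [Finite 𝓀[K]] (hD : IsRamifiedQuadraticDatum σ ϖ d t) (h2v : Valued.v (2 : K) < 1)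
    (e : ℕ) (he : 1 ≤ e) {N : ℕ} (hN : 2 * e + (2 * d - 1) ≤ N) {κ : K} (hσκ : σ κ = κ) (hκ : Valued.v κ * Valued.v ϖ ^ (2 * e) ≤ Valued.v ϖ)
    (S : Finset K) (hS1 : ∀ y ∈ S, σ y = y ∧ Valued.v y = Valued.v ϖ ^ (2 * e))
    (hS2 : ∀ y : K, σ y = y → Valued.v y = Valued.v ϖ ^ (2 * e) → ∃ s ∈ S, Valued.v (y - s) ≤ Valued.v ϖ ^ N)
    (hS3 : ∀ s ∈ S, ∀ s' ∈ S, Valued.v (s - s') ≤ Valued.v ϖ ^ N → s = s') :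
    ∑ y ∈ S, normSign σ y * normSign σ (1 + y) * normSign σ (1 + κ * y * (1 + y)⁻¹) = 0 := by
  obtain ⟨hσ, hvσ, hϖ, -, -, hd1, -⟩ := id hD
  have hϖ1 : Valued.v ϖ < 1 := by rw [hϖ, ← exp_zero]; exact exp_lt_exp.2 (by norm_num)
  have hϖ1' : Valued.v ϖ ≤ 1 := hϖ1.le
  have hvϖ0 : Valued.v ϖ ≠ 0 := by rw [hϖ]; exact exp_ne_zero
  have hq : ∀ n : ℕ, Valued.v ϖ ^ n = exp (-(n : ℤ)) := fun n => by rw [hϖ, ← exp_nsmul]; congr 1; simp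
  obtain ⟨c, hσc, hc1, hcd, hcn⟩ := exists_fixed_unit_not_norm_v_sub_one_le hD h2v
  have hcd' : Valued.v (c - 1) ≤ Valued.v ϖ ^ (2 * (d - 1)) := by rw [hq]; push_cast [Nat.cast_sub hd1] at hcd ⊢; exact hcd
  -- shell letters
  have hyv : ∀ y : K, Valued.v y = Valued.v ϖ ^ (2 * e) → Valued.v y < 1 := fun y hvy => by
    rw [hvy]; exact pow_lt_one₀ zero_le hϖ1 (by omega)
  have hy0 : ∀ y : K, Valued.v y = Valued.v ϖ ^ (2 * e) → y ≠ 0 := fun y hvy h0 => by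
    rw [h0, map_zero] at hvy; exact pow_ne_zero _ hvϖ0 hvy.symm
  have hκyv : ∀ y : K, Valued.v y = Valued.v ϖ ^ (2 * e) → Valued.v (κ * y) < 1 := fun y hvy => by
    rw [map_mul, hvy]; exact hκ.trans_lt hϖ1
  have hκyle : ∀ y : K, Valued.v y = Valued.v ϖ ^ (2 * e) → Valued.v (κ * y) ≤ Valued.v ϖ := fun y hvy => by rw [map_mul, hvy]; exact hκ
  have hNle : Valued.v ϖ ^ N ≤ Valued.v ϖ ^ (2 * d - 1) * Valued.v ϖ ^ (2 * e) := by
    rw [← pow_add]; exact pow_le_pow_right_of_le_one' hϖ1' (by omega)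
  -- precision of `κ·(y − y′)` on a class: `|κ|·|ϖ|^N ≤ |ϖ|^{1 + N − 2e} ≤ |ϖ|^{2d−1}`
  have hκN : ∀ y y' : K, Valued.v (y' - y) ≤ Valued.v ϖ ^ N → Valued.v (κ * (y' - y)) ≤ Valued.v ϖ ^ (2 * d - 1) := fun y y' h => by
    rw [map_mul]
    have h1 : Valued.v κ * Valued.v (y' - y) ≤ Valued.v κ * (Valued.v ϖ ^ (2 * d - 1) * Valued.v ϖ ^ (2 * e)) := mul_le_mul' le_rfl (h.trans hNle)
    refine h1.trans ?_
    calc Valued.v κ * (Valued.v ϖ ^ (2 * d - 1) * Valued.v ϖ ^ (2 * e))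
        = Valued.v ϖ ^ (2 * d - 1) * (Valued.v κ * Valued.v ϖ ^ (2 * e)) := by rw [mul_left_comm]
      _ ≤ Valued.v ϖ ^ (2 * d - 1) * Valued.v ϖ := mul_le_mul' le_rfl hκ
      _ ≤ Valued.v ϖ ^ (2 * d - 1) := mul_le_of_le_one_right' hϖ1'
  refine sum_eq_zero_of_classIsometry_flip (A := {y : K | σ y = y ∧ Valued.v y = Valued.v ϖ ^ (2 * e)}) S hS1
    (fun y hy => hS2 y hy.1 hy.2) hS3 (fun y => c * y) ?_ ?_ (fun y => normSign σ y * normSign σ (1 + y) * normSign σ (1 + κ * y * (1 + y)⁻¹)) ?_ ?_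
  · rintro y ⟨hσy, hvy⟩
    exact ⟨by rw [map_mul, hσc, hσy], by rw [map_mul, hc1, one_mul, hvy]⟩
  · rintro y - y' -
    rw [← mul_sub, map_mul, hc1, one_mul]
  · -- class functions
    rintro y ⟨hσy, hvy⟩ y' ⟨hσy', hvy'⟩ hyy'
    have hyy'' : Valued.v (y' - y) ≤ Valued.v ϖ ^ N := by rwa [Valuation.map_sub_swap]
    have h1 : normSign σ y = normSign σ y' :=
      (normSign_eq_of_rel_near hD hσy hσy' (hy0 y hvy) le_rfl (hyy'.trans (by rw [hvy]; exact hNle))).symm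
    have h2 : normSign σ (1 + y') = normSign σ (1 + y) :=
      normSign_one_add_eq_of_sub_le hD hσy hσy' (hyv y hvy) (le_refl (2 * d - 1)) ((hyy''.trans hNle).trans (mul_le_of_le_one_right' (pow_le_one₀ zero_le hϖ1')))
    have h3 : normSign σ (1 + κ * y' * (1 + y')⁻¹) = normSign σ (1 + κ * y * (1 + y)⁻¹) :=
      normSign_twist_eq_of_sub_le hD hσκ hσy hσy' (hyv y hvy) (hyv y' hvy') (hκyv y hvy) (le_refl (2 * d - 1)) (hκN y y' hyy'')
    rw [h1, h2, h3]
  · -- the flip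
    rintro y ⟨hσy, hvy⟩
    have hσcy : σ (c * y) = c * y := by rw [map_mul, hσc, hσy]
    have hvcy : Valued.v (c * y) = Valued.v ϖ ^ (2 * e) := by rw [map_mul, hc1, one_mul, hvy]
    -- `|cy − y| = |c − 1|·|y| ≤ |ϖ|^{2d−2+2e} ≤ |ϖ|^{2d−1}·(…)`
    have hdiff : Valued.v (c * y - y) ≤ Valued.v ϖ ^ (2 * (d - 1) + 2 * e) := by
      rw [show c * y - y = (c - 1) * y by ring, map_mul, hvy, pow_add]
      exact mul_le_mul' hcd' le_rfl
    have h2d : Valued.v ϖ ^ (2 * (d - 1) + 2 * e) ≤ Valued.v ϖ ^ (2 * d - 1) := pow_le_pow_right_of_le_one' hϖ1' (by omega)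
    have h2 : normSign σ (1 + c * y) = normSign σ (1 + y) :=
      normSign_one_add_eq_of_sub_le hD hσy hσcy (hyv y hvy) (le_refl (2 * d - 1)) (hdiff.trans h2d)
    have hκdiff : Valued.v (κ * (c * y - y)) ≤ Valued.v ϖ ^ (2 * d - 1) := by
      rw [show κ * (c * y - y) = (κ * y) * (c - 1) by ring, map_mul]
      calc Valued.v (κ * y) * Valued.v (c - 1) ≤ Valued.v ϖ * Valued.v ϖ ^ (2 * (d - 1)) := mul_le_mul' (hκyle y hvy) hcd'
        _ = Valued.v ϖ ^ (2 * d - 1) := by rw [← pow_succ']; congr 1; omega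
    have h3 : normSign σ (1 + κ * (c * y) * (1 + c * y)⁻¹) = normSign σ (1 + κ * y * (1 + y)⁻¹) :=
      normSign_twist_eq_of_sub_le hD hσκ hσy hσcy (hyv y hvy) (hyv _ hvcy) (hκyv y hvy) (le_refl (2 * d - 1)) hκdiff
    rw [h2, h3, normSign_mul_eq_neg_of_not_norm hD hσc hcn hσy (hy0 y hvy)]
    ring


/-! ## §3  The slot-`2` column of the G₃ capped tube vanishes (R5b (β3) slot 2; in fact on the WHOLE capped tube, cell or not) -/

section SlotTwo

variable [CompleteSpace K] [Fintype 𝓀[K]] {α β : K} {N₀ n₁ n₂ n₃ : ℕ}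

/-- **THE SIGN OF THE NORMAL FORM IN SLOT `2`**: on `M(g)` with polarisation `D(g) ∘ (0 2) = π₀^{−(ρ+t)}·(−(1+g)⁻¹, 1, g)` (★ p861619), the (β1) sign `ω(S)·ω(D₂)`, `S = D₀(π₀^{k₁}e_B − π₀^{ρ+t}e_C) +
D₁N((1+g)⁻¹)π₀^{k₁}e_B`, is `ω(e_C)·(ω(g)·ω(1+g)·ω(1 + κg(1+g)⁻¹))`, `κ = −(e_B e_C⁻¹ π₀^{k₁}(π₀^{ρ+t})⁻¹)` — since `S = (1+g)⁻¹·e_C·(1 + κg(1+g)⁻¹)`, `ω((1+g)⁻¹) = ω(1+g)`,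
`ω((π₀^{ρ+t})⁻¹) = 1` (★ `normSign_mul_of_fixed`, ★ `normSign_mul_norm`). [cite: LanglandsShelstad1987, §3] [cite: Serre1979, Ch. V §3 Cor. 3] -/
theorem normSign_linearSum_mul_normSign_D₂_G3_rep (hD : IsRamifiedQuadraticDatum σ ϖ d t) (ρ tt k₁ : ℕ) (htt : 1 ≤ tt)
    {g : K} (hσg : σ g = g) (hg : Valued.v g = Valued.v ϖ ^ (2 * tt)) {eC eB : K} (hσeC : σ eC = eC) (heC1 : Valued.v eC = 1) (hσeB : σ eB = eB) (heB1 : Valued.v eB = 1)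
    (hκ : Valued.v (-(eB * eC⁻¹ * (ϖ * σ ϖ) ^ k₁ * ((ϖ * σ ϖ) ^ (ρ + tt))⁻¹)) * Valued.v ϖ ^ (2 * tt) ≤ Valued.v ϖ) :
    normSign σ (-(((ϖ * σ ϖ) ^ (ρ + tt))⁻¹ * (1 + g)⁻¹) * ((ϖ * σ ϖ) ^ k₁ * eB - (ϖ * σ ϖ) ^ (ρ + tt) * eC) +
          ((ϖ * σ ϖ) ^ (ρ + tt))⁻¹ * (σ (1 + g)⁻¹ * (1 + g)⁻¹) * ((ϖ * σ ϖ) ^ k₁ * eB)) * normSign σ (((ϖ * σ ϖ) ^ (ρ + tt))⁻¹ * g) =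
      normSign σ eC * (normSign σ g * normSign σ (1 + g) *
        normSign σ (1 + -(eB * eC⁻¹ * (ϖ * σ ϖ) ^ k₁ * ((ϖ * σ ϖ) ^ (ρ + tt))⁻¹) * g * (1 + g)⁻¹)) := by
  obtain ⟨hσ, hvσ, hϖ, -, -, -, -⟩ := id hD
  haveI : Finite 𝓀[K] := Finite.of_fintype _
  obtain ⟨hϖ0, hϖ1⟩ := ne_zero_and_v_lt_one_of_v_eq_exp hϖ
  set π₀ : K := ϖ * σ ϖ with hπ₀
  set κ : K := -(eB * eC⁻¹ * π₀ ^ k₁ * (π₀ ^ (ρ + tt))⁻¹) with hκdef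
  have hσπ₀ : σ π₀ = π₀ := by rw [hπ₀, map_mul, hσ, mul_comm]
  have hπ₀0 : π₀ ≠ 0 := mul_ne_zero hϖ0 (fun h => hϖ0 (by simpa [hσ] using congrArg σ h))
  have hP0 : π₀ ^ (ρ + tt) ≠ 0 := pow_ne_zero _ hπ₀0
  have hgv : Valued.v g < 1 := by rw [hg]; exact pow_lt_one₀ zero_le hϖ1 (by omega)
  have hg0 : g ≠ 0 := fun h => by rw [h, map_zero] at hg; exact (pow_ne_zero _ ((Valuation.pos_iff _).2 hϖ0).ne') hg.symm
  have h1g : Valued.v (1 + g) = 1 := Valued.v.map_one_add_of_lt hgv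
  have h1g0 : (1 : K) + g ≠ 0 := fun h => by rw [h, map_zero] at h1g; exact zero_ne_one h1g
  have hσ1g : σ (1 + g) = 1 + g := by rw [map_add, map_one, hσg]
  have heC0 : eC ≠ 0 := fun h => by rw [h, map_zero] at heC1; exact zero_ne_one heC1
  have heB0 : eB ≠ 0 := fun h => by rw [h, map_zero] at heB1; exact zero_ne_one heB1
  have hσκ : σ κ = κ := by rw [hκdef, map_neg, map_mul, map_mul, map_mul, map_inv₀, map_inv₀, map_pow, map_pow, hσπ₀, hσeB, hσeC]
  -- the twist `ψ = 1 + κ g (1+g)⁻¹` is a fixed unit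
  have hψv : Valued.v (1 + κ * g * (1 + g)⁻¹) = 1 := Valued.v.map_one_add_of_lt (by
    rw [map_mul, map_inv₀, h1g, inv_one, mul_one, map_mul, hg]; exact hκ.trans_lt hϖ1)
  have hψ0 : 1 + κ * g * (1 + g)⁻¹ ≠ 0 := fun h => by rw [h, map_zero] at hψv; exact zero_ne_one hψv
  have hσψ : σ (1 + κ * g * (1 + g)⁻¹) = 1 + κ * g * (1 + g)⁻¹ := by rw [map_add, map_one, map_mul, map_mul, map_inv₀, hσκ, hσg, hσ1g]
  -- the algebra: `S = (1+g)⁻¹ · e_C · ψ`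
  have hS : -((π₀ ^ (ρ + tt))⁻¹ * (1 + g)⁻¹) * (π₀ ^ k₁ * eB - π₀ ^ (ρ + tt) * eC) + (π₀ ^ (ρ + tt))⁻¹ * (σ (1 + g)⁻¹ * (1 + g)⁻¹) * (π₀ ^ k₁ * eB) =
      (1 + g)⁻¹ * (eC * (1 + κ * g * (1 + g)⁻¹)) := by
    rw [map_inv₀, hσ1g, hκdef]
    field_simp
    ring
  rw [hS, normSign_mul_of_fixed hD (by rw [map_inv₀, hσ1g]) (by rw [map_mul, hσeC, hσψ]) (inv_ne_zero h1g0) (mul_ne_zero heC0 hψ0),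
    normSign_mul_of_fixed hD hσeC hσψ heC0 hψ0,
    normSign_mul_of_fixed hD (by rw [map_inv₀, map_pow, hσπ₀]) hσg (inv_ne_zero hP0) hg0]
  -- `ω((1+g)⁻¹) = ω(1+g)` and `ω((π₀^{ρ+t})⁻¹) = 1`
  have hinv : normSign σ (1 + g)⁻¹ = normSign σ (1 + g) := by
    have e : (1 + g)⁻¹ = (1 + g) * ((1 + g)⁻¹ * σ (1 + g)⁻¹) := by rw [map_inv₀, hσ1g]; field_simp
    rw [e, F0P3cDyRamFixedCountDiagonalModel.normSign_mul_norm σ (1 + g) (inv_ne_zero h1g0)]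
  have hnorm : normSign σ (π₀ ^ (ρ + tt))⁻¹ = 1 := by
    unfold normSign
    rw [if_pos ⟨(ϖ ^ (ρ + tt))⁻¹, by rw [map_inv₀, map_pow, ← mul_inv, ← mul_pow]⟩]
  rw [hinv, hnorm]
  ring

open Classical in
/-- **R5b (β3), SLOT 2: THE OWN-SLOT COLUMN OF THE G₃ CAPPED TUBE VANISHES** (ANY capped tube class: read `2ρ + s + ℓ₀ = n₃`, `2 ∣ s`, guard `2ρ + 2 + ℓ₀ ≤ min n₁ n₂`; `2 ≤ d ≤ N₀`, `mcOfRecord d ≤ N₀`,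
`|2| < 1`; token `e_C`): `Σᶠ_{M ∈ stratum (2ρ+s,2ρ+s,2ρ), shell} m^Λ_2(M) ∕ [𝒰 : N(S̃(M))] = 0` — ★ p861619 `_of_read` (orbit reps `M(g)`) ∘ ★ p861675 (β1) per-rep value ∘ ★ p861738 (β2) `indicator_two`
(`= [2d−1 ≤ ρ]`, uniform in `g`) ∘ §3 sign ∘ §2 flip sum (`e = t`, `N = ρ + 2t ≥ 2t + 2d − 1`). [cite: Kottwitz1986BaseChangeUnits, §1 pp. 240–241] [cite: LanglandsShelstad1987, §3]
[cite: Rogawski1990, §4.9 Prop. 4.9.1 (a)(b) p. 55] -/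
theorem finsum_stratum_G3_shell_labelledOdd_div_relIndex_slot_two_eq_zero (hD : IsRamifiedQuadraticDatum σ ϖ d t) (h2 : Valued.v (2 : K) < 1) (h2d : 2 ≤ d)
    (hE : IsElementDatum σ ϖ N₀ α β n₁ n₂ n₃) (hN₀ : d ≤ N₀) (hmc : mcOfRecord d ≤ N₀)
    (T : GL (Fin 3) K) (hT : (T : Matrix (Fin 3) (Fin 3) K) = Matrix.diagonal ![α, β, 1]) (ρ s : ℕ) (hρ : 1 ≤ ρ)
    (hP : 2 * ρ + s + d % 2 = n₃) (h2s : 2 ∣ s) (hcap : 2 * ρ + 2 + d % 2 ≤ min n₁ n₂)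
    {eC : K} (hσeC : σ eC = eC) (heC1 : Valued.v eC = 1)
    (heC : Valued.v ((ϖ ^ mstarOfRecord d)⁻¹ * ((β - α) * ((ϖ * σ ϖ) ^ ((n₃ - d % 2) / 2))⁻¹ - eC * ((ϖ - σ ϖ) * ((ϖ * σ ϖ) ^ ((d - d % 2) / 2))⁻¹))) ≤ 1) :
    ∑ᶠ M ∈ {M : Submodule 𝒪[K] (Fin 3 → K) | M ∈ stratum σ ϖ T ![2 * ρ + s, 2 * ρ + s, 2 * ρ] ∧
        (LatticeInLevel ϖ (d % 2) (Matrix.diagonal ![α - 1, β - 1, 0]) M ∧ ¬ LatticeInLevel ϖ (d % 2 + 1) (Matrix.diagonal ![α - 1, β - 1, 0]) M ∧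
          LatticeInLevel ϖ (mcOfRecord d) (Matrix.diagonal ![(α - 1) * (α - 1), (β - 1) * (β - 1), 0]) M)},
      (labelledOddCount σ ϖ 0 2 (valueClassLabel σ ϖ (α - 1) (β - 1) (mstarOfRecord d) d) M : ℚ) /
        ((((unitStabilizer M).map (unitNormMap σ 3)).relIndex (fixedUnitTorus σ 3) : ℕ) : ℚ) = 0 := by
  obtain ⟨hσ, hvσ, hϖ, hfix, hdd, hd1, -⟩ := id hD
  haveI : Finite 𝓀[K] := Finite.of_fintype _
  obtain ⟨hϖ0, hϖ1⟩ := ne_zero_and_v_lt_one_of_v_eq_exp hϖ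
  have hvϖ : 0 < Valued.v ϖ := (Valuation.pos_iff _).2 hϖ0
  have hmsv : mstarOfRecord d = d % 2 + 2 * d - 1 := rfl
  obtain ⟨hp1, -, -⟩ := depth_mod_two_eq_of_isElementDatum hD hE hN₀
  have hiso := isoceles_of_isElementDatum hD hE
  have hc1 : 2 * ρ + 2 + d % 2 ≤ n₁ := hcap.trans (min_le_left _ _)
  have hc2 : 2 * ρ + 2 + d % 2 ≤ n₂ := hcap.trans (min_le_right _ _)
  obtain ⟨tt, rfl⟩ := h2s
  have htt : 1 ≤ tt := by rcases hiso with ⟨h1, h3⟩ | ⟨h1, -⟩ | ⟨h1, -⟩ <;> omega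
  have hP' : 2 * ρ + 2 * tt + d % 2 = n₃ := hP
  have hρ₁ : 2 * ρ + 2 * tt ≤ n₃ := by omega
  have hρ₂ : 2 * ρ ≤ n₂ := by omega
  have hρ₃ : ρ ≤ n₁ := by omega
  -- the class representatives
  obtain ⟨R₀, hR₀fin, -, hR1, hR2, hR3⟩ := exists_fixed_class_representatives hσ hvσ hfix hϖ hdd ρ tt hρ
  set R : Finset K := hR₀fin.toFinset with hRdef
  have hmemR : ∀ g, g ∈ R ↔ g ∈ R₀ := fun g => Set.Finite.mem_toFinset hR₀fin
  have hR1' : ∀ g ∈ R, σ g = g ∧ Valued.v g = Valued.v ϖ ^ (2 * tt) := fun g hg => hR1 g ((hmemR g).1 hg)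
  have hR2' : ∀ f : K, σ f = f → Valued.v f = Valued.v ϖ ^ (2 * tt) → ∃ g ∈ R, Valued.v (f - g) ≤ Valued.v ϖ ^ (ρ + 2 * tt) :=
    fun f hσf hvf => by obtain ⟨g, hg, h⟩ := hR2 f hσf hvf; exact ⟨g, (hmemR g).2 hg, h⟩
  have hR3' : ∀ g ∈ R, ∀ g' ∈ R, Valued.v (g - g') ≤ Valued.v ϖ ^ (ρ + 2 * tt) → g = g' :=
    fun g hg g' hg' h => hR3 g ((hmemR g).1 hg) g' ((hmemR g').1 hg') h
  rw [finsum_stratum_G3_shell_labelledOdd_div_relIndex_eq_card_mul_sum_of_read hD h2 hE hmc T hT ρ tt hρ htt hP' hcap R hR1' hR2' hR3' 0 2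
    (isTorusEquivariantLabel_valueClassLabel σ ϖ (α - 1) (β - 1) (mstarOfRecord d) d)]
  refine mul_eq_zero_of_right _ ?_
  -- the `e_B` token and the exponents
  have hN₁ : N₀ ≤ n₁ := hE.2.2.2.2.2.2.2.2.1
  obtain ⟨eB, hσeB, heB1, heB⟩ := exists_towerSign_of_mcOfRecord_le hD hE.2.1 hE.2.2.2.2.2.1 hp1 (hmc.trans hN₁)
  have hk₃ : (n₃ - d % 2) / 2 = ρ + tt := by omega
  rw [hk₃, hmsv] at heC
  rw [hmsv] at heB
  set k₁ : ℕ := (n₁ - d % 2) / 2 with hk₁def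
  have hk₃' : 2 * (ρ + tt) + d % 2 = n₃ := by omega
  have hk₁ : 2 * k₁ + d % 2 = n₁ := by omega
  have hn₁ : 2 * ρ + d % 2 + 1 ≤ n₁ := by omega
  set κ : K := -(eB * eC⁻¹ * (ϖ * σ ϖ) ^ k₁ * ((ϖ * σ ϖ) ^ (ρ + tt))⁻¹) with hκdef
  have heC0 : eC ≠ 0 := fun h => by rw [h, map_zero] at heC1; exact zero_ne_one heC1
  have hσπ₀ : σ (ϖ * σ ϖ) = ϖ * σ ϖ := by rw [map_mul, hσ, mul_comm]
  have hvπ₀ : Valued.v (ϖ * σ ϖ) = Valued.v ϖ ^ 2 := by rw [map_mul, hvσ, pow_two]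
  have hσκ : σ κ = κ := by rw [hκdef, map_neg, map_mul, map_mul, map_mul, map_inv₀, map_inv₀, map_pow, map_pow, hσπ₀, hσeB, hσeC]
  -- `|κ|·|ϖ|^{2t} = |ϖ|^{n₁ − ℓ₀ − 2ρ} ≤ |ϖ|` (guard: `n₁ − ℓ₀ − 2ρ ≥ 2`)
  have hvπ : Valued.v (ϖ * σ ϖ) = exp (-2 : ℤ) := by
    rw [map_mul, hvσ, hϖ, ← WithZero.exp_add]; norm_num
  have hvκ : Valued.v κ = exp ((2 * ((ρ + tt : ℕ) : ℤ) - 2 * (k₁ : ℤ))) := by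
    rw [hκdef, Valuation.map_neg, map_mul, map_mul, map_mul, map_inv₀, map_inv₀, map_pow, map_pow, heB1, heC1, inv_one, one_mul, one_mul, hvπ,
      ← WithZero.exp_nsmul, ← WithZero.exp_nsmul, ← WithZero.exp_neg, ← WithZero.exp_add]
    congr 1
    simp only [nsmul_eq_mul]
    push_cast
    ring
  have hκ : Valued.v κ * Valued.v ϖ ^ (2 * tt) ≤ Valued.v ϖ := by
    rw [hvκ, hϖ, ← WithZero.exp_nsmul, ← WithZero.exp_add, WithZero.exp_le_exp]
    simp only [nsmul_eq_mul]
    push_cast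
    omega
  -- per representative: the (β1) value on `M(g)` with `D(g)`, the (β2) indicator, the §3 sign
  have hsv := v_diag_eq_one hvσ hE
  have hreg := diag_regular hE
  have hπ₀ : σ (((ϖ * σ ϖ) ^ (ρ + tt))⁻¹) = ((ϖ * σ ϖ) ^ (ρ + tt))⁻¹ := by rw [map_inv₀, map_pow, hσπ₀]
  have hπ₀0 : ((ϖ * σ ϖ) ^ (ρ + tt))⁻¹ ≠ (0 : K) :=
    inv_ne_zero (pow_ne_zero _ (mul_ne_zero hϖ0 (fun h => hϖ0 (by simpa [hσ] using congrArg σ h))))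
  have hw₀ := fun g (hg : g ∈ R) => stabiliserWeight_latt_G3_rep_eq hD (ρ := ρ) hρ htt (hR1' g hg).1 (hR1' g hg).2
  have hterm : ∀ g ∈ R,
      (labelledOddCount σ ϖ 0 2 (valueClassLabel σ ϖ (α - 1) (β - 1) (mstarOfRecord d) d)
            (latt (!![1, 0, 0; (1 + g)⁻¹, ϖ ^ (ρ + 2 * tt), 0; (1 + g)⁻¹, -(ϖ ^ (ρ + 2 * tt) * g⁻¹), ϖ ^ (2 * ρ)] : Matrix (Fin 3) (Fin 3) K)) : ℚ) /
          ((((unitStabilizer (latt (!![1, 0, 0; (1 + g)⁻¹, ϖ ^ (ρ + 2 * tt), 0; (1 + g)⁻¹, -(ϖ ^ (ρ + 2 * tt) * g⁻¹), ϖ ^ (2 * ρ)] : Matrix (Fin 3) (Fin 3) K))).map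
              (unitNormMap σ 3)).relIndex (fixedUnitTorus σ 3) : ℕ) : ℚ) =
        (if 2 * d - 1 ≤ ρ then
          (normSign σ eC : ℚ) / 2 * ((((Nat.card 𝓀[K] - 1) * Nat.card 𝓀[K] ^ ((ρ + 2 * tt + 1) / 2 - 1)) * ((Nat.card 𝓀[K] - 1) * Nat.card 𝓀[K] ^ (ρ - 1)) : ℕ) : ℚ)⁻¹ else 0) *
          ((normSign σ g * normSign σ (1 + g) * normSign σ (1 + κ * g * (1 + g)⁻¹) : ℤ) : ℚ) := by
    intro g hg
    obtain ⟨hσg, hvg⟩ := hR1' g hg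
    have hgv : Valued.v g < 1 := by rw [hvg]; exact pow_lt_one₀ zero_le hϖ1 (by omega)
    have hg0 : g ≠ 0 := fun h => by rw [h, map_zero] at hvg; exact (pow_ne_zero _ hvϖ.ne') hvg.symm
    have h1g : Valued.v (1 + g) = 1 := Valued.v.map_one_add_of_lt hgv
    have h1g0 : (1 : K) + g ≠ 0 := fun h => by rw [h, map_zero] at h1g; exact zero_ne_one h1g
    have hx : Valued.v (1 + g)⁻¹ = 1 := by rw [map_inv₀, h1g, inv_one]
    have hz : Valued.v (-(ϖ ^ (ρ + 2 * tt) * g⁻¹)) = Valued.v (ϖ ^ ρ) := by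
      rw [Valuation.map_neg, map_mul, map_inv₀, hvg, map_pow, map_pow, pow_add, mul_assoc, mul_inv_cancel₀ (pow_ne_zero _ hvϖ.ne'), mul_one]
    have hmem := latt_G3_rep_mem_stratum_of_depths hD hE T hT hρ htt hρ₁ hρ₂ hρ₃ hσg hvg
    obtain ⟨hlev, hnlev, hsq⟩ := shell_of_mem_stratum_G3_of_guard hD hE hmc T ρ (2 * tt) hρ (by omega) hcap hP' hmem
    have hfin := finite_unitTorus_orbit_of_mem_normalisedStableLattices hϖ hsv hreg T hT hmem.1
    have hD₁ : ∀ j, σ ((![-(((ϖ * σ ϖ) ^ (ρ + tt))⁻¹ * (1 + g)⁻¹), ((ϖ * σ ϖ) ^ (ρ + tt))⁻¹, ((ϖ * σ ϖ) ^ (ρ + tt))⁻¹ * g] : Fin 3 → K) j) =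
        (![-(((ϖ * σ ϖ) ^ (ρ + tt))⁻¹ * (1 + g)⁻¹), ((ϖ * σ ϖ) ^ (ρ + tt))⁻¹, ((ϖ * σ ϖ) ^ (ρ + tt))⁻¹ * g] : Fin 3 → K) j ∧
        (![-(((ϖ * σ ϖ) ^ (ρ + tt))⁻¹ * (1 + g)⁻¹), ((ϖ * σ ϖ) ^ (ρ + tt))⁻¹, ((ϖ * σ ϖ) ^ (ρ + tt))⁻¹ * g] : Fin 3 → K) j ≠ 0 := by
      intro j; fin_cases j
      · exact ⟨by simp [map_neg, map_mul, map_inv₀, map_add, hπ₀, hσg], by simpa using mul_ne_zero hπ₀0 (inv_ne_zero h1g0)⟩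
      · exact ⟨by simpa using hπ₀, by simpa using hπ₀0⟩
      · exact ⟨by simp [map_mul, hπ₀, hσg], by simpa using mul_ne_zero hπ₀0 hg0⟩
    have hV₁ := isVertexLattice_zero_latt_G3_rep hσ hvσ hϖ ρ tt htt hσg hvg
    have hTM := mapGL_latt_G3_rep_of_depths hvσ hϖ hE T hT htt hρ₁ hρ₂ hρ₃ hvg
    have hval := labelledOddCount_div_relIndex_twoSlot_latt_G3 hD h2d hE hmc T hT hρ (by omega : 1 ≤ 2 * tt) hx hx hz (ρ + tt) (by ring) hk₃'
      k₁ hk₁ hn₁ rfl hTM hD₁ hV₁ hlev hnlev hsq hfin hσeC heC1 heC hσeB heB1 heB 2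
    have hind := indicator_two_latt_G3_iff hD h2 hρ (by omega : 1 ≤ 2 * tt) hx hx hz hσg (by rw [map_pow]; exact hvg) (by ring) (ρ + tt) (by ring)
      k₁ hk₁ hn₁ rfl hD₁ hV₁ hσeC heC1 hσeB heB1
    simp only [Matrix.cons_val_zero, Matrix.cons_val_one, Matrix.cons_val_two, Matrix.head_cons, Matrix.tail_cons] at hval hind
    have hsgn := normSign_linearSum_mul_normSign_D₂_G3_rep hD ρ tt k₁ htt hσg hvg hσeC heC1 hσeB heB1 hκ
    rw [hmsv, hval, hw₀ g hg]
    by_cases hρd : 2 * d - 1 ≤ ρ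
    · rw [if_pos (hind.2 hρd), if_pos hρd, ← Int.cast_mul, hsgn]
      push_cast
      ring
    · rw [if_neg (fun h => hρd (hind.1 h)), if_neg hρd]
      push_cast
      ring
  rw [Finset.sum_congr rfl hterm, ← Finset.mul_sum]
  by_cases hρd : 2 * d - 1 ≤ ρ
  · have hsum := sum_normSign_mul_one_add_mul_twist_eq_zero hD h2 tt htt (N := ρ + 2 * tt) (by omega) hσκ hκ R hR1' hR2' hR3'
    have hsumQ : ∑ g ∈ R, ((normSign σ g * normSign σ (1 + g) * normSign σ (1 + κ * g * (1 + g)⁻¹) : ℤ) : ℚ) = 0 := by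
      rw [← Int.cast_sum, hsum, Int.cast_zero]
    rw [hsumQ, mul_zero]
  · rw [if_neg hρd, zero_mul]

end SlotTwo

end Summit.HodgeConjecture.HodgeConjecture.Cruxes.H413.F0P3cDyRamLabelledOddBoundaryG3SlotTwo

end
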